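import Summits.Ventures.LatticeQCDFlow.Scaling.TwoLevelCycleAutomaton

/-!
HONEST FRAMING: exact (Metropolis-corrected) sampling algorithms for lattice gauge theory; figures
of merit are autocorrelation/cost numbers at stated couplings and volumes; no continuum-physics
claim.

# RedrawCycleCoalescence — FROM A PER-REFRESH-CYCLE CONTRACTION TO COALESCENCE: IF A CHAIN `Q = h·R + M` (REDRAW PART `R`, REST `M`) HAS AN
# ABSORBING SET AND A POTENTIAL `Ψ` WITH `R·1_{¬C} ≤ Ψ ≤ Ψ_max` AND `R·H_n ≤ (1−ρ)Ψ` (`H_n` = EXPECTED `h·Ψ` COLLECTED BEFORE THE NEXT REDRAW, `n`-TRUNCATED),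
# THEN `Qⁿ·1_{¬C} ≤ (1−ρ)^k·Ψ_max + P(Bin(n,h) ≤ k) ≤ (1−ρ)^k·Ψ_max + x^{−k}(1−h+hx)ⁿ` FOR EVERY `k` (lean-2 GEN-31, ours)

Venture-side (OURS).  Cell `lqcd-flow` (pub-lqcd), unit `pub-lqcd-lean-2-g31`, 2026-08-29.  Chapter R, file 7: the generic second half of the certificate programme
of `lean-2/MEMO-gen31-coupling-certificate.md` (OPEN-MATH-chapterM items 1 (i)/(ii) for `K ≥ 2`).  There the chain `Q` is the synchronous coupling (chapter P, file 1) of two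
copies of the persistent hub, `R` the common hot redraw, `M = t·G + z·1` the rest, `C` the diagonal (coalesced pairs, absorbing since the coupling is sticky), and `Ψ` the
conjectured potential `(D + ζ·N_bad)·1{D ≥ 1}`; the hypothesis `R·H_n ≤ (1−ρ)·Ψ` is exactly "one refresh cycle, started at the redraw, contracts `Ψ` by `1 − ρ`" (the
operator `C' = R·h(1 − M)⁻¹` of the memo, truncated at `n` steps so that no inverse is needed), which the toy computations there exhibit with `ρ ≍ (p/K)·min{1,t/h}` for the
Boolean star and for the three-point star.  Here everything is abstract: a finite type `Z`, matrices `Q, R, M`, a `[0,1]`-valued function `ind` (the indicator of the non-absorbed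
states) with `Q·ind ≤ ind`, and hypothesis-equations for the recursions `H`, `F`, `B` — no definitions, no probability.

## What is proved

* `cyc_mulVec_mono` (entrywise non-negative matrices are monotone), `cyc_pow_ind_le` (`Qⁿ·ind ≤ ind`), `cyc_H_le` (`H_n ≤ Ψ_max`).
* **`cyc_split`** — `Qⁿ·ind ≤ F_{k+1,n} + B_{k,n}` where `F_{k+1,n+1} = M·F_{k+1,n} + h·R·F_{k,n}`, `F_{0,n} = Qⁿ·ind`, `F_{k+1,0} = 0` (the mass with at least `k+1` redraws)
  and `B_{k,n+1} = (1−h)B_{k,n} + h·B_{k−1,n}`, `B_{0,n+1} = (1−h)B_{0,n}`, `B_{k,0} = 1` (the probability of at most `k` redraws in `n` steps).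
* **`cyc_F_le`** — `F_{k+1,n} ≤ (1−ρ)^k·H_n` (each completed cycle contracts, by `R·H_n ≤ (1−ρ)Ψ`; the first redraw costs `R·Qⁿ·ind ≤ R·ind ≤ Ψ`).
* `cyc_B_le` — `B_{k,n} ≤ x^{−k}·(1−h+hx)ⁿ` for `0 < x ≤ 1` (the generating-function tail bound, by induction on the recursion).
* **`cyc_coalescence`** — `(Qⁿ·ind)(z) ≤ (1−ρ)^k·Ψ_max + x^{−k}·(1−h+hx)ⁿ` for all `n, k`, `0 < x ≤ 1`.
* **`cyc_worstTvDist_le`** — the same bound for `d(n)` of a chain `P` with stationary `π`, when `Q` on `X × X` is a Markovian coupling of `P` (LPW Cor. 5.5, tree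
  `LevinPeres2017_cor_5_5`) and `ind = 1{a ≠ b}`.

Reading (no numerics implied): with `ind = 1{x ≠ y}` on pairs and `Q` a sticky Markovian coupling, `(Qⁿ·ind)(x,y) = P_{x,y}{X_n ≠ Y_n} ≥ ‖Pⁿ(x,·) − Pⁿ(y,·)‖_TV`, so a per-cycle
certificate with `ρ ≍ (p/K)·min{1,t/h}` yields `t_mix = O((K/(p·min{t,h}))·log(Ψ_max/ε))` — the conjectured law of item 1; what remains for `K ≥ 2` is the per-cycle
inequality itself (STEP 1 of the memo).  NOT CLAIMED: that inequality for any `K ≥ 2`; anything measured.  Literature grade (cell rule): OWN, elementary; nothing cited as a fact;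
no new bib keys.
-/

noncomputable section

open Finset Function Matrix
open Literature.Probability.MarkovChains

namespace Summit.Ventures.LatticeQCDFlow.Scaling

variable {Z : Type*} [Fintype Z] [DecidableEq Z]

section Cycle
variable {Q R M : Matrix Z Z ℝ} {h ρ Ψmax : ℝ} {Ψ ind : Z → ℝ}

omit [DecidableEq Z] in
/-- Entrywise non-negative matrices act monotonically on vectors. [ours] -/
theorem cyc_mulVec_mono {A : Matrix Z Z ℝ} (hA : ∀ z z', 0 ≤ A z z') {f g : Z → ℝ} (hfg : ∀ z, f z ≤ g z) (z : Z) :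
    (A *ᵥ f) z ≤ (A *ᵥ g) z := by
  simp only [Matrix.mulVec, dotProduct]
  exact sum_le_sum fun z' _ => mul_le_mul_of_nonneg_left (hfg z') (hA z z')

omit [DecidableEq Z] in
/-- A matrix with constant row sums `s` maps a constant bound to `s` times it: `f ≤ c ⇒ A·f ≤ s·c`. [ours] -/
theorem cyc_mulVec_le_const {A : Matrix Z Z ℝ} (hA : ∀ z z', 0 ≤ A z z') {s : ℝ} (hAs : ∀ z, ∑ z', A z z' = s) {f : Z → ℝ} {c : ℝ}
    (hf : ∀ z, f z ≤ c) (z : Z) : (A *ᵥ f) z ≤ s * c := by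
  simp only [Matrix.mulVec, dotProduct]
  calc ∑ z', A z z' * f z' ≤ ∑ z', A z z' * c := sum_le_sum fun z' _ => mul_le_mul_of_nonneg_left (hf z') (hA z z')
    _ = s * c := by rw [← sum_mul, hAs]

omit [DecidableEq Z] in
/-- A matrix with constant row sums `s` maps the constant function `c` to the constant `s·c`. [ours] -/
theorem cyc_mulVec_le_const_eq {A : Matrix Z Z ℝ} (_hA : ∀ z z', 0 ≤ A z z') {s : ℝ} (hAs : ∀ z, ∑ z', A z z' = s) {c : ℝ} (z : Z) :
    (A *ᵥ fun _ => c) z = s * c := by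
  simp only [Matrix.mulVec, dotProduct]
  rw [← sum_mul, hAs]

/-- **`Qⁿ·ind ≤ ind`** for a `[0,1]`-valued `ind` with `Q·ind ≤ ind` and `Q ≥ 0` (the non-absorbed mass never grows). [ours] -/
theorem cyc_pow_ind_le (hQ0 : ∀ z z', 0 ≤ Q z z') (hstick : ∀ z, (Q *ᵥ ind) z ≤ ind z) (n : ℕ) (z : Z) :
    ((Q ^ n) *ᵥ ind) z ≤ ind z := by
  induction n generalizing z with
  | zero => rw [pow_zero, Matrix.one_mulVec]
  | succ n ih =>
    rw [pow_succ', ← Matrix.mulVec_mulVec]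
    exact (cyc_mulVec_mono hQ0 ih z).trans (hstick z)

omit [DecidableEq Z] in
/-- **`H_n ≤ Ψ_max`**: the `h·Ψ` collected over the steps before the next redraw (`H_0 = 0`, `H_{n+1} = h·Ψ + M·H_n`, `M ≥ 0` with row sums `1 − h`,
`0 ≤ h`, `0 ≤ Ψ ≤ Ψ_max`) is at most `Ψ_max`, and non-negative. [ours] -/
theorem cyc_H_le (hM0 : ∀ z z', 0 ≤ M z z') (hM1 : ∀ z, ∑ z', M z z' = 1 - h) (hh0 : 0 ≤ h)
    (hΨ0 : ∀ z, 0 ≤ Ψ z) (hΨmax : ∀ z, Ψ z ≤ Ψmax) {H : ℕ → Z → ℝ} (hH0 : H 0 = 0) (hHs : ∀ n, H (n + 1) = h • Ψ + M *ᵥ H n)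
    (n : ℕ) (z : Z) : 0 ≤ H n z ∧ H n z ≤ Ψmax := by
  have hΨmax0 : 0 ≤ Ψmax := (hΨ0 z).trans (hΨmax z)
  induction n generalizing z with
  | zero => rw [hH0]; exact ⟨le_rfl, hΨmax0⟩
  | succ n ih =>
    rw [hHs, Pi.add_apply, Pi.smul_apply, smul_eq_mul]
    constructor
    · refine add_nonneg (mul_nonneg hh0 (hΨ0 z)) ?_
      simp only [Matrix.mulVec, dotProduct]
      exact sum_nonneg fun z' _ => mul_nonneg (hM0 z z') (ih z').1
    · have h1 := cyc_mulVec_le_const hM0 hM1 (fun z' => (ih z').2) z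
      nlinarith [mul_le_mul_of_nonneg_left (hΨmax z) hh0]

/-- **THE SPLIT AT `k+1` REDRAWS:** `Qⁿ·ind ≤ F_{k+1,n} + B_{k,n}` with the recursions of the file header (`Q = h·R + M`, `R ≥ 0` stochastic,
`M ≥ 0` with row sums `1−h`, `0 ≤ ind ≤ 1`). [ours] -/
theorem cyc_split (hQ : Q = h • R + M) (hR0 : ∀ z z', 0 ≤ R z z') (hR1 : ∀ z, ∑ z', R z z' = 1) (hM0 : ∀ z z', 0 ≤ M z z')
    (hM1 : ∀ z, ∑ z', M z z' = 1 - h) (hh0 : 0 ≤ h) (hind : ∀ z, 0 ≤ ind z ∧ ind z ≤ 1)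
    {F : ℕ → ℕ → Z → ℝ} (hF0 : ∀ n, F 0 n = (Q ^ n) *ᵥ ind) (hFk0 : ∀ k, F (k + 1) 0 = 0)
    (hFs : ∀ k n, F (k + 1) (n + 1) = M *ᵥ F (k + 1) n + h • (R *ᵥ F k n))
    {B : ℕ → ℕ → ℝ} (hBk0 : ∀ k, B k 0 = 1) (hB0s : ∀ n, B 0 (n + 1) = (1 - h) * B 0 n)
    (hBs : ∀ k n, B (k + 1) (n + 1) = (1 - h) * B (k + 1) n + h * B k n) (n : ℕ) :
    ∀ (k : ℕ) (z : Z), ((Q ^ n) *ᵥ ind) z ≤ F (k + 1) n z + B k n := by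
  induction n with
  | zero =>
    intro k z
    rw [pow_zero, Matrix.one_mulVec, hFk0, hBk0, Pi.zero_apply, zero_add]
    exact (hind z).2
  | succ n ih =>
    intro k z
    have hstep : ((Q ^ (n + 1)) *ᵥ ind) z = h * (R *ᵥ ((Q ^ n) *ᵥ ind)) z + (M *ᵥ ((Q ^ n) *ᵥ ind)) z := by
      rw [pow_succ', ← Matrix.mulVec_mulVec, hQ, Matrix.add_mulVec, Matrix.smul_mulVec, Pi.add_apply, Pi.smul_apply, smul_eq_mul]
    rw [hstep]
    rcases Nat.eq_zero_or_pos k with hk | hk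
    · -- `k = 0`: the first redraw contributes `h·R·(Qⁿ ind) = h·R·F_{0,n}`, the rest splits by the induction hypothesis at `k = 0`
      subst hk
      rw [hFs, hB0s, Pi.add_apply, Pi.smul_apply, smul_eq_mul, hF0]
      have hMpart : (M *ᵥ ((Q ^ n) *ᵥ ind)) z ≤ (M *ᵥ F 1 n) z + (1 - h) * B 0 n := by
        have h1 := cyc_mulVec_mono hM0 (fun z' => ih 0 z') z
        have h2 : (M *ᵥ fun z' => F (0 + 1) n z' + B 0 n) z = (M *ᵥ F 1 n) z + (1 - h) * B 0 n := by
          have : (fun z' => F (0 + 1) n z' + B 0 n) = F 1 n + fun _ => B 0 n := by funext z'; rfl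
          rw [this, Matrix.mulVec_add, Pi.add_apply, cyc_mulVec_le_const_eq hM0 hM1]
        linarith [h1, h2.le, h2.ge]
      linarith [hMpart]
    · obtain ⟨k', rfl⟩ : ∃ k', k = k' + 1 := ⟨k - 1, by omega⟩
      rw [hFs, hBs, Pi.add_apply, Pi.smul_apply, smul_eq_mul]
      have hMpart : (M *ᵥ ((Q ^ n) *ᵥ ind)) z ≤ (M *ᵥ F (k' + 1 + 1) n) z + (1 - h) * B (k' + 1) n := by
        have h1 := cyc_mulVec_mono hM0 (fun z' => ih (k' + 1) z') z
        have h2 : (M *ᵥ fun z' => F (k' + 1 + 1) n z' + B (k' + 1) n) z = (M *ᵥ F (k' + 1 + 1) n) z + (1 - h) * B (k' + 1) n := by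
          have : (fun z' => F (k' + 1 + 1) n z' + B (k' + 1) n) = F (k' + 1 + 1) n + fun _ => B (k' + 1) n := by funext z'; rfl
          rw [this, Matrix.mulVec_add, Pi.add_apply, cyc_mulVec_le_const_eq hM0 hM1]
        linarith [h1, h2.le, h2.ge]
      have hRpart : (R *ᵥ ((Q ^ n) *ᵥ ind)) z ≤ (R *ᵥ F (k' + 1) n) z + B k' n := by
        have h1 := cyc_mulVec_mono hR0 (fun z' => ih k' z') z
        have h2 : (R *ᵥ fun z' => F (k' + 1) n z' + B k' n) z = (R *ᵥ F (k' + 1) n) z + 1 * B k' n := by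
          have : (fun z' => F (k' + 1) n z' + B k' n) = F (k' + 1) n + fun _ => B k' n := by funext z'; rfl
          rw [this, Matrix.mulVec_add, Pi.add_apply, cyc_mulVec_le_const_eq hR0 hR1]
        linarith [h1, h2.le, h2.ge]
      nlinarith [mul_le_mul_of_nonneg_left hRpart hh0, hMpart]

/-- **EACH COMPLETED CYCLE CONTRACTS:** `F_{k+1,n} ≤ (1−ρ)^k·H_n`, from the per-cycle hypothesis `R·H_n ≤ (1−ρ)·Ψ` (all `n`), the first-redraw bound
`R·ind ≤ Ψ`, stickiness `Q·ind ≤ ind`, and the recursions. [ours] -/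
theorem cyc_F_le (hQ0 : ∀ z z', 0 ≤ Q z z') (hR0 : ∀ z z', 0 ≤ R z z') (hM0 : ∀ z z', 0 ≤ M z z') (hh0 : 0 ≤ h) (hρ1 : ρ ≤ 1)
    (hstick : ∀ z, (Q *ᵥ ind) z ≤ ind z) (hΨind : ∀ z, (R *ᵥ ind) z ≤ Ψ z)
    {H : ℕ → Z → ℝ} (hHs : ∀ n, H (n + 1) = h • Ψ + M *ᵥ H n) (hH0' : ∀ z, 0 ≤ H 0 z) (hcyc : ∀ n z, (R *ᵥ H n) z ≤ (1 - ρ) * Ψ z)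
    {F : ℕ → ℕ → Z → ℝ} (hF0 : ∀ n, F 0 n = (Q ^ n) *ᵥ ind) (hFk0 : ∀ k, F (k + 1) 0 = 0)
    (hFs : ∀ k n, F (k + 1) (n + 1) = M *ᵥ F (k + 1) n + h • (R *ᵥ F k n)) (n : ℕ) :
    ∀ (k : ℕ) (z : Z), F (k + 1) n z ≤ (1 - ρ) ^ k * H n z := by
  induction n with
  | zero =>
    intro k z
    rw [hFk0, Pi.zero_apply]
    exact mul_nonneg (pow_nonneg (by linarith) _) (hH0' z)
  | succ n ih =>
    intro k z
    rw [hFs, hHs, Pi.add_apply, Pi.smul_apply, smul_eq_mul, Pi.add_apply, Pi.smul_apply, smul_eq_mul]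
    have hMpart : (M *ᵥ F (k + 1) n) z ≤ (1 - ρ) ^ k * (M *ᵥ H n) z := by
      have h1 := cyc_mulVec_mono hM0 (fun z' => ih k z') z
      have h2 : (M *ᵥ fun z' => (1 - ρ) ^ k * H n z') z = (1 - ρ) ^ k * (M *ᵥ H n) z := by
        have : (fun z' => (1 - ρ) ^ k * H n z') = (1 - ρ) ^ k • H n := by funext z'; simp
        rw [this, Matrix.mulVec_smul, Pi.smul_apply, smul_eq_mul]
      linarith [h1, h2.le, h2.ge]
    rcases Nat.eq_zero_or_pos k with hk | hk
    · -- first redraw: `R·F_{0,n} = R·Qⁿ·ind ≤ R·ind ≤ Ψ`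
      subst hk
      have hR1 : (R *ᵥ F 0 n) z ≤ Ψ z := by
        rw [hF0]
        exact (cyc_mulVec_mono hR0 (cyc_pow_ind_le hQ0 hstick n) z).trans (hΨind z)
      simp only [pow_zero, one_mul] at hMpart ⊢
      nlinarith [mul_le_mul_of_nonneg_left hR1 hh0]
    · obtain ⟨k', rfl⟩ : ∃ k', k = k' + 1 := ⟨k - 1, by omega⟩
      have hR1 : (R *ᵥ F (k' + 1) n) z ≤ (1 - ρ) ^ k' * ((1 - ρ) * Ψ z) := by
        have h1 := cyc_mulVec_mono hR0 (fun z' => ih k' z') z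
        have h2 : (R *ᵥ fun z' => (1 - ρ) ^ k' * H n z') z = (1 - ρ) ^ k' * (R *ᵥ H n) z := by
          have : (fun z' => (1 - ρ) ^ k' * H n z') = (1 - ρ) ^ k' • H n := by funext z'; simp
          rw [this, Matrix.mulVec_smul, Pi.smul_apply, smul_eq_mul]
        have h3 := mul_le_mul_of_nonneg_left (hcyc n z) (pow_nonneg (show (0:ℝ) ≤ 1 - ρ by linarith) k')
        linarith [h1, h2.le, h2.ge]
      have e : (1 - ρ) ^ (k' + 1) = (1 - ρ) ^ k' * (1 - ρ) := pow_succ _ _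
      rw [e] at hMpart ⊢
      nlinarith [mul_le_mul_of_nonneg_left hR1 hh0]

omit [Fintype Z] [DecidableEq Z] in
/-- **THE GENERATING-FUNCTION TAIL BOUND:** `B_{k,n} ≤ x^{−k}·(1 − h + h·x)ⁿ` for `0 < x ≤ 1`, `0 ≤ h ≤ 1` (so `P(Bin(n,h) ≤ k) ≤ x^{−k}·E[x^{Bin(n,h)}]`),
proved from the recursion alone. [ours] -/
theorem cyc_B_le (hh0 : 0 ≤ h) (hh1 : h ≤ 1) {x : ℝ} (hx0 : 0 < x) (hx1 : x ≤ 1)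
    {B : ℕ → ℕ → ℝ} (hBk0 : ∀ k, B k 0 = 1) (hB0s : ∀ n, B 0 (n + 1) = (1 - h) * B 0 n)
    (hBs : ∀ k n, B (k + 1) (n + 1) = (1 - h) * B (k + 1) n + h * B k n) (n : ℕ) :
    ∀ k : ℕ, B k n ≤ (x ^ k)⁻¹ * (1 - h + h * x) ^ n := by
  induction n with
  | zero =>
    intro k
    rw [hBk0, pow_zero, mul_one]
    exact one_le_inv_iff₀.mpr ⟨pow_pos hx0 k, pow_le_one₀ hx0.le hx1⟩
  | succ n ih =>
    intro k
    have hc0 : 0 ≤ 1 - h + h * x := by nlinarith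
    rcases Nat.eq_zero_or_pos k with hk | hk
    · subst hk
      rw [hB0s]
      have h1 := ih 0
      simp only [pow_zero, inv_one, one_mul] at h1 ⊢
      rw [pow_succ]
      have hB0 : (1 - h) * B 0 n ≤ (1 - h) * (1 - h + h * x) ^ n := mul_le_mul_of_nonneg_left h1 (by linarith)
      nlinarith [pow_nonneg hc0 n, mul_nonneg hh0 hx0.le]
    · obtain ⟨k', rfl⟩ : ∃ k', k = k' + 1 := ⟨k - 1, by omega⟩
      rw [hBs]
      have h1 := mul_le_mul_of_nonneg_left (ih (k' + 1)) (show (0:ℝ) ≤ 1 - h by linarith)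
      have h2 := mul_le_mul_of_nonneg_left (ih k') hh0
      have hxk : 0 < x ^ k' := pow_pos hx0 k'
      have e1 : (x ^ (k' + 1))⁻¹ = (x ^ k')⁻¹ * x⁻¹ := by rw [pow_succ, mul_inv]
      have e2 : (x ^ k')⁻¹ = (x ^ (k' + 1))⁻¹ * x := by
        rw [e1, mul_assoc, inv_mul_cancel₀ hx0.ne', mul_one]
      rw [e2] at h2
      calc (1 - h) * B (k' + 1) n + h * B k' n
          ≤ (1 - h) * ((x ^ (k' + 1))⁻¹ * (1 - h + h * x) ^ n) + h * ((x ^ (k' + 1))⁻¹ * x * (1 - h + h * x) ^ n) := add_le_add h1 h2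
        _ = (x ^ (k' + 1))⁻¹ * (1 - h + h * x) ^ (n + 1) := by rw [pow_succ]; ring

/-- **FROM A PER-CYCLE CONTRACTION TO COALESCENCE.**  `Q = h·R + M` on a finite type (`R ≥ 0` stochastic, `M ≥ 0` with row sums `1 − h`, `0 ≤ h ≤ 1`),
`ind : Z → [0,1]` with `Q·ind ≤ ind` (the indicator of the non-absorbed states of a chain with an absorbing set), `0 ≤ Ψ ≤ Ψ_max` with `R·ind ≤ Ψ`, and the
`n`-truncated cycle sums `H` (`H_0 = 0`, `H_{n+1} = h·Ψ + M·H_n`) satisfying the per-cycle contraction `R·H_n ≤ (1−ρ)·Ψ` for all `n` (`ρ ≤ 1`).  Then for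
all `n, k` and `0 < x ≤ 1`: `(Qⁿ·ind)(z) ≤ (1−ρ)^k·Ψ_max + x^{−k}·(1−h+h·x)ⁿ`.  (The recursions `F`, `B` of `cyc_split` are instantiated inside the proof.) [ours] -/
theorem cyc_coalescence (hQ : Q = h • R + M) (hR0 : ∀ z z', 0 ≤ R z z') (hR1 : ∀ z, ∑ z', R z z' = 1) (hM0 : ∀ z z', 0 ≤ M z z')
    (hM1 : ∀ z, ∑ z', M z z' = 1 - h) (hh0 : 0 ≤ h) (hh1 : h ≤ 1) (hρ1 : ρ ≤ 1) (hind : ∀ z, 0 ≤ ind z ∧ ind z ≤ 1)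
    (hstick : ∀ z, (Q *ᵥ ind) z ≤ ind z) (hΨ0 : ∀ z, 0 ≤ Ψ z) (hΨmax : ∀ z, Ψ z ≤ Ψmax) (hΨind : ∀ z, (R *ᵥ ind) z ≤ Ψ z)
    {H : ℕ → Z → ℝ} (hH0 : H 0 = 0) (hHs : ∀ n, H (n + 1) = h • Ψ + M *ᵥ H n) (hcyc : ∀ n z, (R *ᵥ H n) z ≤ (1 - ρ) * Ψ z)
    (n k : ℕ) {x : ℝ} (hx0 : 0 < x) (hx1 : x ≤ 1) (z : Z) :
    ((Q ^ n) *ᵥ ind) z ≤ (1 - ρ) ^ k * Ψmax + (x ^ k)⁻¹ * (1 - h + h * x) ^ n := by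
  have hQ0 : ∀ z z', 0 ≤ Q z z' := by
    intro z z'; rw [hQ, Matrix.add_apply, Matrix.smul_apply, smul_eq_mul]
    exact add_nonneg (mul_nonneg hh0 (hR0 z z')) (hM0 z z')
  -- the two recursions, as functions defined by well-founded recursion on `ℕ`
  let F : ℕ → ℕ → Z → ℝ := fun k => Nat.rec (motive := fun _ => ℕ → Z → ℝ) (fun n => (Q ^ n) *ᵥ ind)
    (fun _ Fk => fun n => Nat.rec (motive := fun _ => Z → ℝ) 0 (fun m Fk1m => M *ᵥ Fk1m + h • (R *ᵥ Fk m)) n) k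
  have hF0 : ∀ n, F 0 n = (Q ^ n) *ᵥ ind := fun n => rfl
  have hFk0 : ∀ k, F (k + 1) 0 = 0 := fun k => rfl
  have hFs : ∀ k n, F (k + 1) (n + 1) = M *ᵥ F (k + 1) n + h • (R *ᵥ F k n) := fun k n => rfl
  let B : ℕ → ℕ → ℝ := fun k => Nat.rec (motive := fun _ => ℕ → ℝ) (fun n => (1 - h) ^ n)
    (fun _ Bk => fun n => Nat.rec (motive := fun _ => ℝ) 1 (fun m Bk1m => (1 - h) * Bk1m + h * Bk m) n) k
  have hBk0 : ∀ k, B k 0 = 1 := by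
    intro k; cases k with
    | zero => exact pow_zero _
    | succ k => rfl
  have hB0s : ∀ n, B 0 (n + 1) = (1 - h) * B 0 n := fun n => by
    show (1 - h) ^ (n + 1) = (1 - h) * (1 - h) ^ n
    rw [pow_succ, mul_comm]
  have hBs : ∀ k n, B (k + 1) (n + 1) = (1 - h) * B (k + 1) n + h * B k n := fun k n => rfl
  have h1 := cyc_split hQ hR0 hR1 hM0 hM1 hh0 hind hF0 hFk0 hFs hBk0 hB0s hBs n k z
  have hH0' : ∀ z, 0 ≤ H 0 z := fun z => by rw [hH0, Pi.zero_apply]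
  have h2 := cyc_F_le hQ0 hR0 hM0 hh0 hρ1 hstick hΨind hHs hH0' hcyc hF0 hFk0 hFs n k z
  have h3 := cyc_B_le hh0 hh1 hx0 hx1 hBk0 hB0s hBs n k
  have h4 := (cyc_H_le hM0 hM1 hh0 hΨ0 hΨmax hH0 hHs n z).2
  have h5 : (1 - ρ) ^ k * H n z ≤ (1 - ρ) ^ k * Ψmax := mul_le_mul_of_nonneg_left h4 (pow_nonneg (by linarith) k)
  linarith

end Cycle

/-- **THE TOTAL-VARIATION COROLLARY** (LPW Cor. 5.5 on top of `cyc_coalescence`): if `Q` on `X × X` is a Markovian coupling of `P` with itself satisfying the hypotheses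
of `cyc_coalescence` with `ind = 1{a ≠ b}`, and `π` is stationary for `P`, then **`d(n) ≤ (1−ρ)^k·Ψ_max + x^{−k}·(1−h+h·x)ⁿ`** for all `n, k`, `0 < x ≤ 1`. [ours] -/
theorem cyc_worstTvDist_le {X : Type*} [Fintype X] [DecidableEq X] [Nonempty X] {P : Matrix X X ℝ} {π : X → ℝ}
    (hπ : IsStationary π P) (hπ0 : ∀ x, 0 ≤ π x) (hπ1 : ∑ x, π x = 1)
    {Q R M : Matrix (X × X) (X × X) ℝ} {h ρ Ψmax : ℝ} {Ψ ind : X × X → ℝ} (hQc : IsMarkovianCoupling P Q)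
    (hQ : Q = h • R + M) (hR0 : ∀ z z', 0 ≤ R z z') (hR1 : ∀ z, ∑ z', R z z' = 1) (hM0 : ∀ z z', 0 ≤ M z z')
    (hM1 : ∀ z, ∑ z', M z z' = 1 - h) (hh0 : 0 ≤ h) (hh1 : h ≤ 1) (hρ1 : ρ ≤ 1) (hind : ∀ a b, ind (a, b) = if a = b then 0 else 1)
    (hstick : ∀ z, (Q *ᵥ ind) z ≤ ind z) (hΨ0 : ∀ z, 0 ≤ Ψ z) (hΨmax : ∀ z, Ψ z ≤ Ψmax) (hΨind : ∀ z, (R *ᵥ ind) z ≤ Ψ z)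
    {H : ℕ → X × X → ℝ} (hH0 : H 0 = 0) (hHs : ∀ n, H (n + 1) = h • Ψ + M *ᵥ H n) (hcyc : ∀ n z, (R *ᵥ H n) z ≤ (1 - ρ) * Ψ z)
    (n k : ℕ) {x : ℝ} (hx0 : 0 < x) (hx1 : x ≤ 1) :
    worstTvDist P π n ≤ (1 - ρ) ^ k * Ψmax + (x ^ k)⁻¹ * (1 - h + h * x) ^ n := by
  have hind' : ∀ z, 0 ≤ ind z ∧ ind z ≤ 1 := by
    rintro ⟨a, b⟩; rw [hind]; split_ifs <;> norm_num
  refine LevinPeres2017_cor_5_5 hπ hπ0 hπ1 fun x0 y0 => ⟨Q, hQc, ?_⟩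
  have hoff : ∑ a, ∑ b ∈ univ.erase a, kernelAt Q n (x0, y0) (a, b) = ((Q ^ n) *ᵥ ind) (x0, y0) := by
    simp only [Matrix.mulVec, dotProduct, Fintype.sum_prod_type]
    refine sum_congr rfl fun a _ => ?_
    rw [← Finset.sum_erase univ (f := fun b => (Q ^ n) (x0, y0) (a, b) * ind (a, b)) (by rw [hind, if_pos rfl, mul_zero])]
    refine sum_congr rfl fun b hb => ?_
    rw [hind, if_neg (ne_of_mem_erase hb).symm, mul_one, kernelAt_eq_pow_apply]
  rw [hoff]
  exact cyc_coalescence hQ hR0 hR1 hM0 hM1 hh0 hh1 hρ1 hind' hstick hΨ0 hΨmax hΨind hH0 hHs hcyc n k hx0 hx1 (x0, y0)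

end Summit.Ventures.LatticeQCDFlow.Scaling

end
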